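import Literature.MathematicalPhysics.QuantumFieldTheory.Balaban1983to89.B8Eq115GaugeFixing
import Literature.MathematicalPhysics.QuantumFieldTheory.Balaban1983to89.B7Prop3GeneralAnalytic
import Literature.MathematicalPhysics.QuantumFieldTheory.Balaban1983to89.B7Prop3GeneralRotated

/-!
# `Balaban1983to89.B9Eq358Decomposition` — T. Bałaban, *Propagators for lattice gauge theories in a background field*,
Commun. Math. Phys. **99** (1985) 389–434 [Balaban1985BackgroundPropagators]: (3.55)–(3.59) pp. 401–402 — the
decomposition `Q′_j(U′U) = Q′_j(U) + F′_{2,j}(A)` of the transported block averages and the bounds (3.58), (3.59),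
PROVED from the key estimate of p. 401 (which file 2 `B9Eq357Levels` reduces to its printed inputs), and PROVED outright at `j = 1`

statement-level skeleton of published theorems with citation tags; proofs where landed; nothing here is a claim about the Yang–Mills mass gap

PDF held: `paper:balaban1985-cmp99-background-propagators` (journal page = PDF page + 388; pp. 401–402 = renders
`b2b-balaban-ref1/pages/1985-cmp99-background-propagators/…-p013-x2.png`, `…-p014-x2.png`, READ AS IMAGES by this seat);
[5] = T. Bałaban, *Averaging operations for lattice gauge theories*, CMP **98** (1985) 17–51 [Balaban1985Averaging].

CITATION HEADER / WHAT IS REPRODUCED.  SKELETON row **B9.Eq3.58** ((3.57)–(3.59) p. 402 [PDF 14]; owner r06; `absent` at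
v3.11: *"statement needs a concrete transported Q′_j(U) on 𝔤-valued SITE functions"*) of the cell `lit-balaban` (HOME
`run/shared/lean/pub/lit-balaban/`; Phase-2 seat p06 = unit `lit-balaban-p06`, target by ruling G.5-12/G.5-21).  Print,
verbatim (p. 401): *"Let us consider now the averaging operators Q′_j(U) given by (3.19). We have to find an expansion of
R((U′U)(Γ^{(j)}_{y,x})). By the definitions (52), (53) in [5] … (U′U)(Γ^{(j)}_{y,x}) = \overline{(U′U)}^{j−1}(Γ_{y,x_{j−1}})·…·
\overline{(U′U)}(Γ_{x₂,x₁})(U′U)(Γ_{x₁,x}) = … (3.55) where the sequence of points y = x_j, x_{j−1}, …, x₁, x = x₀ is defined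
by the conditions x_l ∈ B(x_{l+1}), or x ∈ B^l(x_l). We apply the identity (97) [5] (Ũ′^l)(x,x′) =
v_l(x)(U̿′^l)(x,x′)R(Ū^l(x,x′))v_l⁻¹(x′), (3.56) where v_l(x) is given by (160). Using (102), (103) we get (U′U)(Γ^{(j)}_{y,x}) =
v_j(y)·Π_{l=j−1}^{0} R(Ū^{l+1}(Γ^{(j−l−1)}_{y,x_{l+1}}))·[(\overline{R̄^l_{x_{l+1}}U̿′^l})⁻¹(R̄^l_{x_{l+1}}U̿′^l)(Γ_{x_{l+1},x_l})]·
U(Γ^{(j)}_{y,x}). (3.57) … Applying the inequalities (161), (162) [5], we have (1/i) log U̿′^l = Q_l(U, ξA′), |Q_l(U, ξA′)| <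
2α₁L^lξ, |(1/i) log(\overline{R̄^l_{x_{l+1}}U̿′^l})| < O(1)α₁L^{l+1}ξ, |v_j(y) − 1| < O(1)α₁ for α₁ sufficiently small. … and by
the above bounds |(U′U)(Γ^{(j)}_{y,x})(U(Γ^{(j)}_{y,x}))⁻¹ − 1| < O(1)α₁. This implies R((U′U)(Γ^{(j)}_{y,x})) =
R(U(Γ^{(j)}_{y,x})) + F′_{2,j}(A; y, x), F′_{2,j}(A; y, x) = {R(v_j(y)Π_{l=j−1}^{0} …) − 1}R(U(Γ^{(j)}_{y,x})),"*; (p. 402):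
*"and |F′_{2,j}(A; y, x)| ≤ O(1)α₁, (3.58) hence finally (Q′_j(U′U)λ)(y) = (Q′_j(U)λ)(y) + (F′_{2,j}(A)λ)(y), (F′_{2,j}(A)λ)(y) =
Σ_{x∈B^j(y)} L^{−jd}F′_{2,j}(A; y, x)λ(x), and |(F′_{2,j}(A)λ)(y)| ≤ O(1)α₁(Q′_j|λ|)(y). (3.59)"*.
CARRIERS (REUSED BY NAME, nothing restated): the tower of averages `Ū^l = avgIter L U l` ([5] (43), `B7Prop2Explicit`); the
composite contours (52)–(53) of [5] through the tower gauge function `B8Eq115GaugeFixing.tg` (`U(Γ^{(j)}_{y,x}) = tg L (Ū^·) j y j x`,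
`x_{l+1} = fl L x_l`, `B8Ineq130.fl`); `Ũ′^l = tildIter`, `U̿′^l = dbavgCovIter`, `v_l = vcov`, the block frames
`\overline{R̄^lU̿′^l} = wframe` and the twisted transports `(R̄^l U̿′^l)(Γ) = tHol` of `B7Eq92Concrete` ([5] (69), (91), (97)/(160),
(82), (58)); `R(X)Y = XYX⁻¹` = `B7Eq78Linearization.conjR` / `B7Eq92Concrete.Rc`; values in the units of a complete normed
`ℂ`-algebra `𝔸`, every level read on `ℤ^d` (lineage conventions).  NEW objects (defs with bodies): `compT` (3.55)/(53),
`bsite`/`QpC` = the COLLAPSED form of (3.19) on site functions, `QpAbs` = `Q′_j|λ|`, `pFac` = the key quantity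
`P = (U′U)(Γ^{(j)})(U(Γ^{(j)}))⁻¹`, `Fp` = `F′_{2,j}(A; y, x)` as an operator on `𝔸`, `FpOp` = `F′_{2,j}(A)` on site functions.
WHAT THIS FILE PROVES (kernel, 0 sorry, axioms ⊆ {propext, Classical.choice, Quot.sound}):
§2 the decomposition EXACTLY — `Fp_eq` (*"F′_{2,j} = {R(P) − 1}R(U(Γ^{(j)}_{y,x}))"*), `conjR_compT_mul` (*"R((U′U)(Γ)) = R(U(Γ)) +
F′_{2,j}(A; y, x)"*), **`QpC_mul`** (*"(Q′_j(U′U)λ)(y) = (Q′_j(U)λ)(y) + (F′_{2,j}(A)λ)(y)"*), for ALL configurations;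
§4 **(3.58)** `norm_Fp_le`: the key estimate `|P − 1| ≤ ε` ⇒ `|F′_{2,j}(A; y, x)X| ≤ 2ε|X|` (unit-bounded towers), and **(3.59)**
`norm_FpOp_le`: `|(F′_{2,j}(A)λ)(y)| ≤ 2ε(Q′_j|λ|)(y)`;
§5 the key estimate at `j = 1` from `|A_b| ≤ a` ALONE (`norm_pFac_one_sub_one_le`: `≤ e^{dLa} − 1`, by [5] (58),
`B7Prop3GeneralAnalytic.norm_tHol_expCfg_sub_one_le`), hence (3.58)–(3.59) at `j = 1` unconditionally (`norm_FpOp_one_le`).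
File 2 `B9Eq357Levels` proves (3.55)–(3.57) as an exact recursion through the levels and the key estimate for general `j` from its
PRINTED per-level inputs (161)–(163) of [5] (`O(1)α₁` uniform in `j`), which the tree does not discharge at a general background
(HOME/GAPS.md G-B9-p06-1).  NOT HERE: analyticity of
`F′_{2,j}` in `A`; the adjoint expansion `F′*_{2,j}`; (3.60)–(3.61); the identification of the collapsed (3.19) (`QpC`) with the
composite of one-step averages (first form; `B9Eq3113Proof.QpIter` / `B7Eq78Linearization.QprimeIter`).
-/

noncomputable section

open scoped BigOperators
open NormedSpace Finset

namespace Literature.MathematicalPhysics.QuantumFieldTheory.Balaban1983to89.B9Eq358Decomposition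

open B7Prop1Explicit B7Prop2Explicit B7Prop3Flat B7Eq92Concrete MatrixLog B7Prop3GeneralAnalytic B8Eq115GaugeFixing
open B8Ineq130 (fl)
open B7Eq78Linearization (conjR conjR_apply conjR_one conjR_add conjR_sub conjR_smul)
open B7Prop3GeneralRotated (conjR_mul_left norm_conjR_le)

-- `Site` alone would resolve to the torus sites of `Setup.lean`; re-export the `ℤ^d` sites of `B7Prop1Explicit`.
export B7Prop1Explicit (Site)

variable {d : ℕ}
variable {𝔸 : Type*} [NormedRing 𝔸] [NormedAlgebra ℂ 𝔸] [CompleteSpace 𝔸]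

/-! ## §1 The objects: composite contour transporters (3.55), the collapsed `Q′_j` (3.19), `F′_{2,j}` (3.58)–(3.59) -/

section Objects

variable (L : ℕ)

/-- **`U(Γ^{(j)}_{y,x})`**, the transporter along the composite contour of [5] (52)–(53) from the level-`j` site `y` to
the level-`0` site `x ∈ B^j(y)` — (3.55) first line, verbatim p. 401 [PDF 13]: *"(U′U)(Γ^{(j)}_{y,x}) =
\overline{(U′U)}^{j−1}(Γ_{y,x_{j−1}})·…·\overline{(U′U)}(Γ_{x₂,x₁})(U′U)(Γ_{x₁,x}) … where the sequence of points
y = x_j, x_{j−1}, …, x₂, x₁, x = x₀ is defined by the conditions x_l ∈ B(x_{l+1}), or x ∈ B^l(x_l)"* — typed as the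
tower gauge function `B8Eq115GaugeFixing.tg` of the tower of averages `(Ū^l)_l = (avgIter L U l)_l` ([5] (43)) with top
level `j`, at full depth `j` (`x_{l+1} = fl L x_l`; every level read on `ℤ^d`). [cite: Balaban1985BackgroundPropagators, (3.55) p.401] -/
def compT (U : Site d → Fin d → 𝔸ˣ) (j : ℕ) (y x : Site d) : 𝔸ˣ := tg L (fun l => avgIter L U l) j y j x

/-- the site `x_r = L^jy + r` of the block `B^j(y)` (offset `r ∈ [0, L^j)^d`). [cite: Balaban1985BackgroundPropagators, (3.19) p.393] -/
def bsite (j : ℕ) (y : Site d) (r : Fin d → Fin (L ^ j)) : Site d := (((L : ℤ) ^ j) • y) + boxVec (L ^ j) r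

omit [NormedAlgebra ℂ 𝔸] [CompleteSpace 𝔸] in
/-- one block level down (p. 401: *"x_l ∈ B(x_{l+1})"*): `fl L (L^{j+1}y + r) = L^jy + ⌊r/L⌋` componentwise, i.e. the point
below `x ∈ B^{j+1}(y)` lies in `B^j(y)`. [cite: Balaban1985BackgroundPropagators, (3.55) p.401] -/
theorem fl_bsite_succ (hL : 1 ≤ L) (j : ℕ) (y : Site d) (r : Fin d → Fin (L ^ (j + 1))) :
    fl L (bsite L (j + 1) y r)
      = bsite L j y (fun i => ⟨(r i : ℕ) / L, Nat.div_lt_of_lt_mul (by rw [← pow_succ']; exact (r i).isLt)⟩) := by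
  funext i
  have hL0 : (L : ℤ) ≠ 0 := by exact_mod_cast (by omega : L ≠ 0)
  simp only [fl, bsite, Pi.add_apply, Pi.smul_apply, smul_eq_mul, boxVec]
  rw [pow_succ, show (L : ℤ) ^ j * L * y i + ((r i : ℕ) : ℤ) = ((r i : ℕ) : ℤ) + ((L : ℤ) ^ j * y i) * L by ring,
    Int.add_mul_ediv_right _ _ hL0, Int.natCast_div, add_comm]

omit [NormedAlgebra ℂ 𝔸] [CompleteSpace 𝔸] in
/-- p. 401: *"the sequence of points y = x_j, x_{j−1}, …, x₂, x₁, x = x₀ is defined by the conditions x_l ∈ B(x_{l+1}), or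
x ∈ B^l(x_l)"* — for `x = L^jy + r ∈ B^j(y)` the `j`-th point is `y`: `(fl L)^{[j]}x = y`. [cite: Balaban1985BackgroundPropagators, (3.55) p.401] -/
theorem iterate_fl_bsite (hL : 1 ≤ L) :
    ∀ (j : ℕ) (y : Site d) (r : Fin d → Fin (L ^ j)), (fl L)^[j] (bsite L j y r) = y
  | 0, y, r => by
      funext i
      simp [bsite, boxVec]
  | j + 1, y, r => by
      rw [Function.iterate_succ_apply, fl_bsite_succ L hL j y r, iterate_fl_bsite hL j]

/-- **(3.19), collapsed form** p. 393 [PDF 5]: *"(Q′_j(U)λ)(y) = … = Σ_{x∈B^j(y)} L^{−jd}R(U(Γ^{(j)}_{y,x}))λ(x), y ∈ T^{(j)}"*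
with `R(X)Y = XYX⁻¹` (`conjR`), `B^j(y) = L^jy + [0, L^j)^d`. [cite: Balaban1985BackgroundPropagators, (3.19) p.393] -/
def QpC (U : Site d → Fin d → 𝔸ˣ) (j : ℕ) (lam : Site d → 𝔸) (y : Site d) : 𝔸 :=
  ∑ r : Fin d → Fin (L ^ j), ((((L : ℝ) ^ j) ^ d)⁻¹) • conjR (compT L U j y (bsite L j y r)) (lam (bsite L j y r))

/-- `(Q′_j|λ|)(y) = Σ_{x∈B^j(y)} L^{−jd}|λ(x)|`, the right-hand side of (3.59). [cite: Balaban1985BackgroundPropagators, (3.59) p.402] -/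
def QpAbs (j : ℕ) (lam : Site d → 𝔸) (y : Site d) : ℝ :=
  ∑ r : Fin d → Fin (L ^ j), ((((L : ℝ) ^ j) ^ d)⁻¹) * ‖lam (bsite L j y r)‖

/-- **the key quantity of p. 401**: `P = (U′U)(Γ^{(j)}_{y,x})(U(Γ^{(j)}_{y,x}))⁻¹` (*"|(U′U)(Γ^{(j)}_{y,x})(U(Γ^{(j)}_{y,x}))⁻¹ − 1|
< O(1)α₁"*). [cite: Balaban1985BackgroundPropagators, p.401 (3.57)–(3.58)] -/
def pFac (U U' : Site d → Fin d → 𝔸ˣ) (j : ℕ) (y x : Site d) : 𝔸ˣ := compT L (U' * U) j y x * (compT L U j y x)⁻¹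

/-- **`F′_{2,j}(A; y, x)`** p. 401–402: *"R((U′U)(Γ^{(j)}_{y,x})) = R(U(Γ^{(j)}_{y,x})) + F′_{2,j}(A; y, x)"* — typed as the operator
`X ↦ R((U′U)(Γ^{(j)}_{y,x}))X − R(U(Γ^{(j)}_{y,x}))X` on `𝔸` (its printed closed form `{R(P) − 1}R(U(Γ^{(j)}_{y,x}))` is
`Fp_eq`); `U′` is the perturbing configuration (print: `U′ = e^{iξA′}`). [cite: Balaban1985BackgroundPropagators, (3.58) p.402] -/
def Fp (U U' : Site d → Fin d → 𝔸ˣ) (j : ℕ) (y x : Site d) (X : 𝔸) : 𝔸 :=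
  conjR (compT L (U' * U) j y x) X - conjR (compT L U j y x) X

/-- **`(F′_{2,j}(A)λ)(y) = Σ_{x∈B^j(y)} L^{−jd}F′_{2,j}(A; y, x)λ(x)`** p. 402. [cite: Balaban1985BackgroundPropagators, (3.58)–(3.59) p.402] -/
def FpOp (U U' : Site d → Fin d → 𝔸ˣ) (j : ℕ) (lam : Site d → 𝔸) (y : Site d) : 𝔸 :=
  ∑ r : Fin d → Fin (L ^ j), ((((L : ℝ) ^ j) ^ d)⁻¹) • Fp L U U' j y (bsite L j y r) (lam (bsite L j y r))

end Objects

/-! ## §2 The decomposition (3.58), exactly -/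

section Decomposition

variable (L : ℕ)

omit [NormedAlgebra ℂ 𝔸] [CompleteSpace 𝔸] in
/-- `R(X Y) = R(X) R(Y)` on `𝔸` ([5] (57)). [cite: Balaban1985Averaging, (57) p.27] -/
private theorem conjR_mul (X Y : 𝔸ˣ) (Z : 𝔸) : conjR (X * Y) Z = conjR X (conjR Y Z) := conjR_mul_left X Y Z

/-- **the printed closed form** p. 401: *"F′_{2,j}(A; y, x) = {R(v_j(y)Π_{l=j−1}^{0} …) − 1}R(U(Γ^{(j)}_{y,x}))"*, i.e.
`F′_{2,j}(A; y, x) = (R(P) − 1)R(U(Γ^{(j)}_{y,x}))` with `P = (U′U)(Γ^{(j)}_{y,x})(U(Γ^{(j)}_{y,x}))⁻¹` (the product inside `R(·)`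
is `P`, by (3.57)). [cite: Balaban1985BackgroundPropagators, (3.57)–(3.58) p.401] -/
theorem Fp_eq (U U' : Site d → Fin d → 𝔸ˣ) (j : ℕ) (y x : Site d) (X : 𝔸) :
    Fp L U U' j y x X = conjR (pFac L U U' j y x) (conjR (compT L U j y x) X) - conjR (compT L U j y x) X := by
  rw [Fp, pFac, ← conjR_mul, inv_mul_cancel_right]

/-- **p. 401, verbatim: *"This implies R((U′U)(Γ^{(j)}_{y,x})) = R(U(Γ^{(j)}_{y,x})) + F′_{2,j}(A; y, x)"***.
[cite: Balaban1985BackgroundPropagators, (3.58) p.401] -/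
theorem conjR_compT_mul (U U' : Site d → Fin d → 𝔸ˣ) (j : ℕ) (y x : Site d) (X : 𝔸) :
    conjR (compT L (U' * U) j y x) X = conjR (compT L U j y x) X + Fp L U U' j y x X := by
  rw [Fp, add_sub_cancel]

/-- **(3.58)–(3.59), the decomposition, verbatim p. 402: *"hence finally (Q′_j(U′U)λ)(y) = (Q′_j(U)λ)(y) + (F′_{2,j}(A)λ)(y),
(F′_{2,j}(A)λ)(y) = Σ_{x∈B^j(y)} L^{−jd}F′_{2,j}(A; y, x)λ(x)"*** — for the collapsed (3.19). [cite: Balaban1985BackgroundPropagators, (3.58)–(3.59) p.402] -/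
theorem QpC_mul (U U' : Site d → Fin d → 𝔸ˣ) (j : ℕ) (lam : Site d → 𝔸) (y : Site d) :
    QpC L (U' * U) j lam y = QpC L U j lam y + FpOp L U U' j lam y := by
  rw [QpC, QpC, FpOp, ← Finset.sum_add_distrib]
  refine Finset.sum_congr rfl fun r _ => ?_
  rw [← smul_add, conjR_compT_mul]

end Decomposition

/-! ## §4 The bounds (3.58), (3.59) -/

section Bounds

variable (L : ℕ) [NormOneClass 𝔸]

omit [NormedAlgebra ℂ 𝔸] [CompleteSpace 𝔸] in
/-- operator algebra behind (3.58): for unit-bounded `T, T′` with `|T′T⁻¹ − 1| ≤ ε`, `|R(T′)X − R(T)X| ≤ 2ε|X|`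
(`R(T′)X − R(T)X = (T′ − T)XT′⁻¹ + TXT′⁻¹(T − T′)T⁻¹`, `|T′ − T| ≤ |T′T⁻¹ − 1|`). [folklore] -/
private theorem norm_conjR_sub_conjR_le {T T' : 𝔸ˣ} (hT : T ∈ U1 𝔸) (hT' : T' ∈ U1 𝔸) {ε : ℝ}
    (hε : ‖((T' * T⁻¹ : 𝔸ˣ) : 𝔸) - 1‖ ≤ ε) (X : 𝔸) : ‖conjR T' X - conjR T X‖ ≤ 2 * ε * ‖X‖ := by
  obtain ⟨h1, h2⟩ := mem_U1.1 hT
  obtain ⟨h1', h2'⟩ := mem_U1.1 hT'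
  have hε0 : 0 ≤ ε := (norm_nonneg _).trans hε
  have hdiff : ‖((T' : 𝔸ˣ) : 𝔸) - (T : 𝔸)‖ ≤ ε := by
    have e : ((T' : 𝔸ˣ) : 𝔸) - (T : 𝔸) = (((T' * T⁻¹ : 𝔸ˣ) : 𝔸) - 1) * (T : 𝔸) := by
      rw [sub_mul, one_mul, Units.val_mul, mul_assoc, Units.inv_mul, mul_one]
    rw [e]
    calc _ ≤ ‖((T' * T⁻¹ : 𝔸ˣ) : 𝔸) - 1‖ * ‖((T : 𝔸ˣ) : 𝔸)‖ := norm_mul_le _ _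
      _ ≤ ε * 1 := mul_le_mul hε h1 (norm_nonneg _) hε0
      _ = ε := mul_one ε
  have e : conjR T' X - conjR T X
      = (((T' : 𝔸ˣ) : 𝔸) - (T : 𝔸)) * X * ((T'⁻¹ : 𝔸ˣ) : 𝔸)
        + (T : 𝔸) * X * (((T'⁻¹ : 𝔸ˣ) : 𝔸) * (((T : 𝔸ˣ) : 𝔸) - (T' : 𝔸)) * ((T⁻¹ : 𝔸ˣ) : 𝔸)) := by
    simp only [conjR_apply, sub_mul, mul_sub, ← mul_assoc, Units.inv_mul_cancel_right, Units.mul_inv_cancel_right]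
    abel
  rw [e]
  have hd' : ‖((T : 𝔸ˣ) : 𝔸) - (T' : 𝔸)‖ ≤ ε := by rw [← norm_neg, neg_sub]; exact hdiff
  calc _ ≤ ‖(((T' : 𝔸ˣ) : 𝔸) - (T : 𝔸)) * X * ((T'⁻¹ : 𝔸ˣ) : 𝔸)‖
          + ‖(T : 𝔸) * X * (((T'⁻¹ : 𝔸ˣ) : 𝔸) * (((T : 𝔸ˣ) : 𝔸) - (T' : 𝔸)) * ((T⁻¹ : 𝔸ˣ) : 𝔸))‖ := norm_add_le _ _
    _ ≤ ε * ‖X‖ * 1 + 1 * ‖X‖ * (1 * ε * 1) := by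
        gcongr
        · calc _ ≤ ‖(((T' : 𝔸ˣ) : 𝔸) - (T : 𝔸)) * X‖ * ‖((T'⁻¹ : 𝔸ˣ) : 𝔸)‖ := norm_mul_le _ _
            _ ≤ (‖((T' : 𝔸ˣ) : 𝔸) - (T : 𝔸)‖ * ‖X‖) * ‖((T'⁻¹ : 𝔸ˣ) : 𝔸)‖ := by gcongr; exact norm_mul_le _ _
            _ ≤ ε * ‖X‖ * 1 := by gcongr
        · calc _ ≤ ‖(T : 𝔸) * X‖ * ‖((T'⁻¹ : 𝔸ˣ) : 𝔸) * (((T : 𝔸ˣ) : 𝔸) - (T' : 𝔸)) * ((T⁻¹ : 𝔸ˣ) : 𝔸)‖ :=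
              norm_mul_le _ _
            _ ≤ (‖((T : 𝔸ˣ) : 𝔸)‖ * ‖X‖) * ((‖((T'⁻¹ : 𝔸ˣ) : 𝔸)‖ * ‖((T : 𝔸ˣ) : 𝔸) - (T' : 𝔸)‖) * ‖((T⁻¹ : 𝔸ˣ) : 𝔸)‖) := by
                gcongr
                · exact norm_mul_le _ _
                · exact (norm_mul_le _ _).trans (by gcongr; exact norm_mul_le _ _)
            _ ≤ 1 * ‖X‖ * (1 * ε * 1) := by gcongr
    _ = 2 * ε * ‖X‖ := by ring

/-- both towers are unit-bounded ⇒ the composite transporters are. [cite: Balaban1985BackgroundPropagators, (3.55) p.401] -/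
theorem compT_mem {U : Site d → Fin d → 𝔸ˣ} {j : ℕ} (hU : ∀ l ≤ j, ∀ x κ, avgIter L U l x κ ∈ U1 𝔸) (y x : Site d) :
    compT L U j y x ∈ U1 𝔸 :=
  tg_mem (S := U1 𝔸) (fun l hl => hU l hl) y j x

/-- **(3.58)** p. 402 [PDF 14], verbatim: *"|F′_{2,j}(A; y, x)| ≤ O(1)α₁, (3.58)"* — PROVED from the key estimate of p. 401
*"|(U′U)(Γ^{(j)}_{y,x})(U(Γ^{(j)}_{y,x}))⁻¹ − 1| < O(1)α₁"* in operator form: if `|P − 1| ≤ ε` and both towers are unit-bounded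
then `|F′_{2,j}(A; y, x)X| ≤ 2ε|X|` for every `X` (so `O(1) = 2·O(1)_{p.401}`). [cite: Balaban1985BackgroundPropagators, (3.58) p.402] -/
theorem norm_Fp_le {U U' : Site d → Fin d → 𝔸ˣ} {j : ℕ} (hU : ∀ l ≤ j, ∀ x κ, avgIter L U l x κ ∈ U1 𝔸)
    (hU' : ∀ l ≤ j, ∀ x κ, avgIter L (U' * U) l x κ ∈ U1 𝔸) (y x : Site d) {ε : ℝ}
    (hε : ‖((pFac L U U' j y x : 𝔸ˣ) : 𝔸) - 1‖ ≤ ε) (X : 𝔸) :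
    ‖Fp L U U' j y x X‖ ≤ 2 * ε * ‖X‖ :=
  norm_conjR_sub_conjR_le (compT_mem L hU y x) (compT_mem L hU' y x) hε X

omit [NormedAlgebra ℂ 𝔸] [CompleteSpace 𝔸] [NormOneClass 𝔸] in
/-- `(Q′_j|λ|)(y) ≥ 0`. [cite: Balaban1985BackgroundPropagators, (3.59) p.402] -/
theorem QpAbs_nonneg (j : ℕ) (lam : Site d → 𝔸) (y : Site d) : 0 ≤ QpAbs L j lam y :=
  Finset.sum_nonneg fun r _ => by positivity

/-- **(3.59)** p. 402 [PDF 14], verbatim: *"|(F′_{2,j}(A)λ)(y)| ≤ O(1)α₁(Q′_j|λ|)(y). (3.59)"* — PROVED from (3.58) in the form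
just stated: if `|P(y, x)− 1| ≤ ε` for every `x ∈ B^j(y)` then `|(F′_{2,j}(A)λ)(y)| ≤ 2ε(Q′_j|λ|)(y)`.
[cite: Balaban1985BackgroundPropagators, (3.59) p.402] -/
theorem norm_FpOp_le {U U' : Site d → Fin d → 𝔸ˣ} {j : ℕ} (hU : ∀ l ≤ j, ∀ x κ, avgIter L U l x κ ∈ U1 𝔸)
    (hU' : ∀ l ≤ j, ∀ x κ, avgIter L (U' * U) l x κ ∈ U1 𝔸) (lam : Site d → 𝔸) (y : Site d) {ε : ℝ}
    (hε : ∀ r : Fin d → Fin (L ^ j), ‖((pFac L U U' j y (bsite L j y r) : 𝔸ˣ) : 𝔸) - 1‖ ≤ ε) :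
    ‖FpOp L U U' j lam y‖ ≤ 2 * ε * QpAbs L j lam y := by
  rw [FpOp, QpAbs, Finset.mul_sum]
  refine norm_sum_le_of_le _ fun r _ => ?_
  rw [norm_smul, Real.norm_of_nonneg (by positivity)]
  calc _ ≤ ((((L : ℝ) ^ j) ^ d)⁻¹) * (2 * ε * ‖lam (bsite L j y r)‖) :=
        mul_le_mul_of_nonneg_left (norm_Fp_le L hU hU' y _ (hε r) _) (by positivity)
    _ = _ := by ring

end Bounds

/-! ## §5 The key estimate at `j = 1` from the smallness of `A` (no inputs from [5] beyond (58)) -/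

section OneStep

variable (L : ℕ)

/-- at `j = 1` the composite contour is the block contour `Γ_{Ly,x}` and `P = (R_{Ly}U′)(Γ_{Ly,x})`, the twisted transport (58)
of [5] of the perturbation `U′` at the background `U`. [cite: Balaban1985BackgroundPropagators, (3.55) p.401] -/
theorem pFac_one_eq_tHol (hL : 1 ≤ L) (U U' : Site d → Fin d → 𝔸ˣ) (y : Site d) (r : Fin d → Fin L) :
    pFac L U U' 1 y ((L : ℤ) • y + boxVec L r) = tHol U U' ((L : ℤ) • y) (treeWord (boxVec L r)) := by
  simp only [pFac, compT, tg_succ, tg_zero, fl_block hL y r, Nat.sub_self, avgIter_zero, axialFn, sub_self,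
    treeWord_zero, hol_nil, one_mul, add_sub_cancel_left, tHol]

variable [NormOneClass 𝔸]

/-- **the key estimate of p. 401 at `j = 1`, PROVED**: for `U′ = e^{A}` with `|A_b| ≤ a` and a unit-bounded background,
`|(U′U)(Γ_{Ly,x})(U(Γ_{Ly,x}))⁻¹ − 1| ≤ e^{dLa} − 1` for every `x ∈ B(Ly)` (print: `|A| < α₁(Lη)⁻¹`, i.e. `a = α₁L⁻¹` on the
fine lattice, giving `e^{dα₁} − 1 = O(1)α₁`). [cite: Balaban1985BackgroundPropagators, p.401 (3.57)–(3.58)] -/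
theorem norm_pFac_one_sub_one_le (hL : 1 ≤ L) {U : Site d → Fin d → 𝔸ˣ} (hU : ∀ x κ, U x κ ∈ U1 𝔸)
    (A : Site d → Fin d → 𝔸) {a : ℝ} (ha : 0 ≤ a) (hA : ∀ x κ, ‖A x κ‖ ≤ a) (y : Site d) (r : Fin d → Fin L) :
    ‖((pFac L U (expCfg A) 1 y ((L : ℤ) • y + boxVec L r) : 𝔸ˣ) : 𝔸) - 1‖ ≤ Real.exp (d * L * a) - 1 := by
  rw [pFac_one_eq_tHol L hL]
  refine (norm_tHol_expCfg_sub_one_le hU A hA _ _).trans ?_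
  rw [length_treeWord]
  have hl : ((l1 (boxVec L r) : ℕ) : ℝ) ≤ (d : ℝ) * L := by exact_mod_cast l1_boxVec_le L r
  gcongr

/-- hence **(3.58)–(3.59) at `j = 1`, unconditionally**: `|(F′_{2,1}(A)λ)(y)| ≤ 2(e^{dLa} − 1)·(Q′_1|λ|)(y)` for `U′ = e^{A}`,
`|A_b| ≤ a`, unit-bounded `U` and `e^{A}U` (and their one-step averages). [cite: Balaban1985BackgroundPropagators, (3.58)–(3.59) p.402] -/
theorem norm_FpOp_one_le (hL : 1 ≤ L) {U : Site d → Fin d → 𝔸ˣ} (A : Site d → Fin d → 𝔸)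
    (hU : ∀ l ≤ 1, ∀ x κ, avgIter L U l x κ ∈ U1 𝔸) (hU' : ∀ l ≤ 1, ∀ x κ, avgIter L (expCfg A * U) l x κ ∈ U1 𝔸)
    {a : ℝ} (ha : 0 ≤ a) (hA : ∀ x κ, ‖A x κ‖ ≤ a) (lam : Site d → 𝔸) (y : Site d) :
    ‖FpOp L U (expCfg A) 1 lam y‖ ≤ 2 * (Real.exp (d * L * a) - 1) * QpAbs L 1 lam y := by
  refine norm_FpOp_le L hU hU' lam y fun r => ?_
  have hr : bsite L 1 y r = (L : ℤ) • y + boxVec L (fun i => ⟨(r i : ℕ), by simpa using (r i).isLt⟩) := by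
    funext i; simp [bsite, boxVec]
  rw [hr]
  exact norm_pFac_one_sub_one_le L hL (hU 0 (by omega)) A ha hA y _

end OneStep

end Literature.MathematicalPhysics.QuantumFieldTheory.Balaban1983to89.B9Eq358Decomposition

end
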